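import Literature.IUT.HodgeTheaters.GlobalFrobenioidsRealify
import Literature.IUT.HodgeTheaters.GlobalRealifiedFrobenioids
import HarnessLib

/-!
# [IUTchI] Example 3.5 (i) ↔ Example 5.1 (iii): the realification map `Φ(F_mod) → Φ_{𝒞⊩_mod}` — its formulas,
# injectivity and normalisation `log⊢_mod(p_v) ↦ 1` (PROOF-ONLY sequel to `GlobalFrobenioidsRealify.lean`)

Mochizuki, *Inter-universal Teichmüller theory I*, §3, Example 3.5 (i), kurims manuscript (May 2020) p. 84
([IUTchI] Ex 3.5 (i) p.84) [claim: Mochizuki2012, status: disputed]: "`Φ_{𝒞⊩_mod,v} ≅ ord(𝒪^▷_{(F_mod)_v})^pf ⊗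
ℝ_{≥0}`", "each element `p_v` determines an element `log⊢_mod(p_v) ∈ Φ_{𝒞⊩_mod,v}`" (and Ex 5.1 (iii) p. 126:
`𝒞⊩_mod` "may be identified with the realification of `†ℱ^⊛_mod`").

PROOF-ONLY (no definitions; abc-iut-w4-d050, L5-lead RULINGS #24 (4)(a)).  For the map
`EffArithDivisor.realifyMod L : Φ(L) = EffArithDivisor L →+ (Val L →₀ ℝ_{≥0}) = Φ_{𝒞⊩_mod}` of the companion
definitions file (abc-iut-L1's [FrdI] Ex 6.3 divisor monoid → abc-iut-L5-t2's `PhiMod` coordinates):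
* `absRamIdx_pos` — `e_v ≥ 1` (Mathlib `Ideal.ramificationIdx_pos`);
* `realifyMod_apply_inr` / `realifyMod_apply_inl` — the coordinate formulas `n_v / e_v` (finite `v`), `x_v`
  (archimedean `v`);
* `realifyMod_injective` — `Φ(L) ↪ Φ(L)^rlf` ("`M → M^rlf` is injective", [FrdI] Def 2.4 (i));
* `realifyMod_single_absRamIdx` — **the normalisation**: the divisor `e_v · [v] = ord_v(p_v) · [v]` (the `v`-part of
  `div(p_v)`) goes to the unit vector at `v`, i.e. `log⊢_mod(p_v) ↦ 1`; `realifyMod_logMod` — the same with t2's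
  name `InitialThetaData.logMod` at `L = F_mod = fieldOfModuli E`; `realifyMod_arch_single` — at an archimedean `v`
  the coordinate `x` goes to `x ·` (unit vector at `v`) (`log(p_v) = 1`);
* hence every element of `Φ_{𝒞⊩_mod}` is an `ℝ_{≥0}`-combination of images (`phiMod_eq_sum_smul_realifyMod`):
  the image generates `Φ_{𝒞⊩_mod}` over `ℝ_{≥0}`, as a realification should.
The identification of t2's `PhiMod` with abc-iut-L1's intrinsic realification `IsPerfFactorial.Rlf` ([FrdI] Def 2.4 (i);
`DirectSum.realification_eq_directSum`) is NOT done here (recorded after-merge item).  No new Prop fact; no statement of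
the paper is strengthened; no side is taken on [IUTchIII] Cor. 3.12.
-/

noncomputable section

namespace Literature.IUT.HodgeTheaters

open NumberField Literature.AlgebraicGeometry.Frobenioids
open scoped NNReal

section General

variable (L : Type) [Field L] [NumberField L]

/-- `e_v ≥ 1`: the absolute ramification index of a finite place of a number field is positive.
([IUTchI] Ex 3.5 (i) p.84) [claim: Mochizuki2012, status: disputed] -/
theorem absRamIdx_pos (v : FinitePlace L) : 0 < absRamIdx L v := by
  unfold absRamIdx
  exact Ideal.ramificationIdx_pos _ _

/-- … hence nonzero as a real number `≥ 0`. ([IUTchI] Ex 3.5 (i) p.84) [claim: Mochizuki2012, status: disputed] -/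
theorem absRamIdx_cast_ne_zero (v : FinitePlace L) : (absRamIdx L v : ℝ≥0) ≠ 0 :=
  Nat.cast_ne_zero.mpr (absRamIdx_pos L v).ne'

/-- The realification map, unfolded: the finite-place sum of scaled unit vectors plus the archimedean part pushed
forward along `V^arc ↪ V`. ([IUTchI] Ex 3.5 (i) p.84) [claim: Mochizuki2012, status: disputed] -/
theorem realifyMod_eq (d : EffArithDivisor L) :
    EffArithDivisor.realifyMod L d =
      (d.1.sum fun w n => Finsupp.single (Sum.inr w : Val L) ((n : ℝ≥0) * ((absRamIdx L w : ℝ≥0)⁻¹))) +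
        Finsupp.mapDomain (Sum.inl : InfinitePlace L → Val L) (Finsupp.equivFunOnFinite.symm d.2) :=
  rfl

/-- **Coordinate formula at a finite place**: `realifyMod d (v) = n_v / e_v`.
([IUTchI] Ex 3.5 (i) p.84) [claim: Mochizuki2012, status: disputed] -/
theorem realifyMod_apply_inr (d : EffArithDivisor L) (v : FinitePlace L) :
    EffArithDivisor.realifyMod L d (Sum.inr v : Val L) = (d.1 v : ℝ≥0) * ((absRamIdx L v : ℝ≥0)⁻¹) := by
  classical
  rw [realifyMod_eq]
  delta Val
  rw [Finsupp.add_apply, Finsupp.mapDomain_notin_range _ _ (by rintro ⟨w, hw⟩; exact Sum.inl_ne_inr hw),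
    add_zero, Finsupp.sum_apply, Finsupp.sum, Finset.sum_eq_single v]
  · rw [Finsupp.single_eq_same]
  · intro w _ hwv
    exact Finsupp.single_eq_of_ne fun h => hwv (Sum.inr_injective h).symm
  · intro hv
    rw [Finsupp.notMem_support_iff.mp hv, Nat.cast_zero, zero_mul, Finsupp.single_zero, Finsupp.zero_apply]

/-- **Coordinate formula at an archimedean place**: `realifyMod d (v) = x_v`.
([IUTchI] Ex 3.5 (i) p.84) [claim: Mochizuki2012, status: disputed] -/
theorem realifyMod_apply_inl (d : EffArithDivisor L) (v : InfinitePlace L) :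
    EffArithDivisor.realifyMod L d (Sum.inl v : Val L) = d.2 v := by
  classical
  rw [realifyMod_eq]
  delta Val
  rw [Finsupp.add_apply, Finsupp.sum_apply, Finsupp.sum, Finset.sum_eq_zero, zero_add,
    Finsupp.mapDomain_apply Sum.inl_injective]
  · rfl
  · intro w _
    exact Finsupp.single_eq_of_ne Sum.inl_ne_inr

/-- **`Φ(L) ↪ Φ(L)^rlf`**: the realification map is injective (`e_v ≠ 0`; cf. [FrdI] Def 2.4 (i), "`M → M^rlf` is
injective"). ([IUTchI] Ex 3.5 (i) p.84) [claim: Mochizuki2012, status: disputed] -/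
theorem realifyMod_injective : Function.Injective (EffArithDivisor.realifyMod L) := by
  intro d d' h
  refine Prod.ext (Finsupp.ext fun v => ?_) (funext fun v => ?_)
  · have hv := congrArg (fun f : Val L →₀ ℝ≥0 => f (Sum.inr v : Val L)) h
    rw [realifyMod_apply_inr, realifyMod_apply_inr] at hv
    exact_mod_cast mul_right_cancel₀ (inv_ne_zero (absRamIdx_cast_ne_zero L v)) hv
  · have hv := congrArg (fun f : Val L →₀ ℝ≥0 => f (Sum.inl v : Val L)) h
    rwa [realifyMod_apply_inl, realifyMod_apply_inl] at hv

/-- **Normalisation `log⊢_mod(p_v) ↦ 1`**: the effective divisor `e_v · [v] = ord_v(p_v) · [v]` (the `v`-component of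
the arithmetic divisor of the rational prime `p_v`) goes to the unit vector at `v` — abc-iut-L5-t2's coordinate
convention for `Φ_{𝒞⊩_mod,v}`. ([IUTchI] Ex 3.5 (i) p.84) [claim: Mochizuki2012, status: disputed] -/
theorem realifyMod_single_absRamIdx (v : FinitePlace L) :
    EffArithDivisor.realifyMod L (Finsupp.single v (absRamIdx L v), 0) =
      @Finsupp.single (Val L) ℝ≥0 _ (Sum.inr v) 1 := by
  classical
  refine Finsupp.ext fun w => ?_
  rcases w with w | w
  · rw [realifyMod_apply_inl]
    delta Val
    rw [Finsupp.single_eq_of_ne Sum.inl_ne_inr]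
    rfl
  · rw [realifyMod_apply_inr]
    delta Val
    dsimp only
    by_cases hwv : w = v
    · subst hwv
      simp only [Finsupp.single_eq_same]
      exact mul_inv_cancel₀ (absRamIdx_cast_ne_zero L w)
    · rw [Finsupp.single_eq_of_ne (fun h => hwv (Sum.inr_injective h)), Finsupp.single_eq_of_ne hwv,
        Nat.cast_zero, zero_mul]

/-- The prime divisor `[v]` itself goes to `e_v⁻¹ ·` (unit vector at `v`). ([IUTchI] Ex 3.5 (i) p.84)
[claim: Mochizuki2012, status: disputed] -/
theorem realifyMod_single_one (v : FinitePlace L) :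
    EffArithDivisor.realifyMod L (Finsupp.single v 1, 0) =
      @Finsupp.single (Val L) ℝ≥0 _ (Sum.inr v) ((absRamIdx L v : ℝ≥0)⁻¹) := by
  classical
  refine Finsupp.ext fun w => ?_
  rcases w with w | w
  · rw [realifyMod_apply_inl]
    delta Val
    rw [Finsupp.single_eq_of_ne Sum.inl_ne_inr]
    rfl
  · rw [realifyMod_apply_inr]
    delta Val
    dsimp only
    by_cases hwv : w = v
    · subst hwv
      simp only [Finsupp.single_eq_same, Nat.cast_one, one_mul]
    · rw [Finsupp.single_eq_of_ne (fun h => hwv (Sum.inr_injective h)), Finsupp.single_eq_of_ne hwv,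
        Nat.cast_zero, zero_mul]

open scoped Classical in
/-- At an archimedean place (`p_v := e`, `log(p_v) = 1`, §0 p. 35): the coordinate `x` at `v` goes to `x ·` (unit
vector at `v`). ([IUTchI] Ex 3.5 (i) p.84) [claim: Mochizuki2012, status: disputed] -/
theorem realifyMod_arch_single (v : InfinitePlace L) (x : ℝ≥0) :
    EffArithDivisor.realifyMod L (0, Pi.single v x) = @Finsupp.single (Val L) ℝ≥0 _ (Sum.inl v) x := by
  refine Finsupp.ext fun w => ?_
  rcases w with w | w
  · rw [realifyMod_apply_inl]
    delta Val
    dsimp only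
    by_cases hwv : w = v
    · subst hwv
      simp only [Finsupp.single_eq_same, Pi.single_eq_same]
    · rw [Finsupp.single_eq_of_ne (fun h => hwv (Sum.inl_injective h)), Pi.single_eq_of_ne hwv]
  · rw [realifyMod_apply_inr]
    delta Val
    rw [Finsupp.single_eq_of_ne Sum.inr_ne_inl]
    change ((0 : FinitePlace L →₀ ℕ) w : ℝ≥0) * _ = 0
    rw [Finsupp.zero_apply, Nat.cast_zero, zero_mul]

open scoped Classical in
/-- **The image generates `Φ_{𝒞⊩_mod}` over `ℝ_{≥0}`** (as a realification must): every finitely supported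
`f : V(L) → ℝ_{≥0}` is the `ℝ_{≥0}`-combination `Σ_v f(v) ·` (image of the basic divisor at `v`), the basic divisor being
`e_v · [v]` at a finite `v` and the unit archimedean coordinate at an archimedean `v`.
([IUTchI] Ex 3.5 (i) p.84) [claim: Mochizuki2012, status: disputed] -/
theorem phiMod_eq_sum_smul_realifyMod (f : Val L →₀ ℝ≥0) :
    f = f.sum fun v c => c • (match v with
      | Sum.inl w => EffArithDivisor.realifyMod L (0, Pi.single w 1)
      | Sum.inr w => EffArithDivisor.realifyMod L (Finsupp.single w (absRamIdx L w), 0)) := by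
  conv_lhs => rw [← Finsupp.sum_single f]
  refine Finsupp.sum_congr fun v _ => ?_
  rcases v with w | w
  · change @Finsupp.single (Val L) ℝ≥0 _ (Sum.inl w) (f (Sum.inl w)) =
      f (Sum.inl w) • EffArithDivisor.realifyMod L (0, Pi.single w 1)
    rw [realifyMod_arch_single, Finsupp.smul_single, smul_eq_mul, mul_one]
  · change @Finsupp.single (Val L) ℝ≥0 _ (Sum.inr w) (f (Sum.inr w)) =
      f (Sum.inr w) • EffArithDivisor.realifyMod L (Finsupp.single w (absRamIdx L w), 0)
    rw [realifyMod_single_absRamIdx, Finsupp.smul_single, smul_eq_mul, mul_one]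

end General

/-! ### With abc-iut-L5-t2's name `log⊢_mod(p_v)` at `F_mod = fieldOfModuli E` -/

section Mod

variable {F : Type} {K : Type} {Fbar : Type} [Field F] [NumberField F] [Field K]
  [NumberField K] [Algebra F K] [Field Fbar] [Algebra F Fbar] [Algebra K Fbar]
  {E : WeierstrassCurve F} [E.IsElliptic] {l : ℕ} {P : BadPlacePredicates K} (D : InitialThetaData F K Fbar E l P)

/-- **[IUTchI] Ex 3.5 (i), "`p_v` determines an element `log⊢_mod(p_v) ∈ Φ_{𝒞⊩_mod,v}`", through the realification
map**: at `F_mod` (t2's `fieldOfModuli E`) the `v`-component `ord_v(p_v) · [v] = e_v · [v]` of the divisor of `p_v`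
goes to abc-iut-L5-t2's `InitialThetaData.logMod v` — the two coordinate conventions agree.
([IUTchI] Ex 3.5 (i) p.84) [claim: Mochizuki2012, status: disputed] -/
theorem realifyMod_logMod (v : FinitePlace (fieldOfModuli E)) :
    EffArithDivisor.realifyMod (fieldOfModuli E) (Finsupp.single v (absRamIdx (fieldOfModuli E) v), 0) =
      D.logMod (Sum.inr v) :=
  realifyMod_single_absRamIdx (fieldOfModuli E) v

open scoped Classical in
/-- … and at an archimedean `v` of `F_mod` the unit coordinate goes to `logMod v` (`log(p_v) = 1`).
([IUTchI] Ex 3.5 (i) p.84) [claim: Mochizuki2012, status: disputed] -/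
theorem realifyMod_logMod_arch (v : InfinitePlace (fieldOfModuli E)) :
    EffArithDivisor.realifyMod (fieldOfModuli E) (0, Pi.single v 1) = D.logMod (Sum.inl v) :=
  realifyMod_arch_single (fieldOfModuli E) v 1

end Mod

end Literature.IUT.HodgeTheaters

end
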